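import Literature.AlgebraicGeometry.AbelianSchemes.DualIsogenyDegree
import Literature.AlgebraicGeometry.AbelianSchemes.DualIsogenyBaseChange
import Literature.AlgebraicGeometry.AbelianSchemes.AbelianSchemeDualTransportOfBaseChange
import Literature.AlgebraicGeometry.AbelianSchemes.AbelianSchemeFibreHom
import Literature.AlgebraicGeometry.AbelianSchemes.PoincareSheafMulN
import HarnessLib

/-!
# The dual isogeny at the fibres: `(ψ^∨)_s = (ψ_s)^∨`, so `ψ_s` isogeny ⟹ `(ψ^∨)_s` isogeny, and the fibrewise similitude degree law
# ([MumfordFogartyKirwan1994] Ch. 6 §1 Cor. 6.8; [MumfordAV1970] §15 Thm. 1)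

Layer `Literature/AlgebraicGeometry/AbelianSchemes`, namespace `Literature.AlgebraicGeometry.AbelianSchemes.AbelianSchemeOver.DualPair`.
THEOREMS ONLY (no definition, no named fact, no instance, no notation, no `sorry`).  Cell `hodgecm-mathlib`, programme P6 (MOD),
organ **(F-iso)** = ★ `DualIsogenyDegree` ((H4-R2), base `Spec k`) transported to EVERY FIELD-VALUED POINT `s : Spec Ω → S` of an
arbitrary base — the level at which the HEART reads the universal abelian scheme `𝒜 → 𝓨` (fibres `𝒜_t`, `t` a `κ̄`- or `Ω`-point).

## Mathematics

Let `ψ : A′ → B` be a homomorphism of abelian `S`-schemes with dual pairs `D′ = (Â′, 𝒫′)`, `D_B = (B̂, 𝒫_B)` (unit hypotheses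
`hD′`, `hDB`), `ψ^∨ : B̂ → Â′` its dual homomorphism (★ `dualIsogenyOver`; assumed a homomorphism — ★ `isMonHom_dualIsogenyOver` over a
reduced locally Noetherian base), and `s : Spec Ω → S` a field-valued point.  ★ `DualIsogenyBaseChange` («the dual homomorphism
commutes with base change», [MumfordFogartyKirwan1994] Cor. 6.8) says `(ψ ×_S s)^∨ = ψ^∨ ×_S s` for the base-changed dual pairs
`D′_s`, `D_{B,s}`; read as morphisms of abelian varieties over `Ω` (★ `fibreHom`, ★ `homOfIsMonHom`, ★ `dualHom`):

* §1 `fibreHom_eq_homOfIsMonHom_baseChangeHom` (`ψ_s = homOfIsMonHom (ψ ×_S s)`, definitional bookkeeping) and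
  **`fibreHom_dualIsogenyOver_eq_dualHom`**: `(ψ^∨)_s = (ψ_s)^∨ := dualHom (ψ ×_S s) D′_s D_{B,s}`.
* §2 **`isIsogeny_fibreHom_dualIsogenyOver`** — if `ψ_s` is an isogeny then so is `(ψ^∨)_s` (★ `isIsogeny_dualHom` at the fibre).
* §3 **`kerRank_fibreHom_mul_mul_kerRank_fibreHom_dualIsogenyOver_eq`** — the similitude equation OVER `S`,
  `ψ ≫ λ_B ≫ ψ^∨ = λ_{A′} ≫ [c]_{Â′}` (`c ≥ 1`), base-changes to the fibre (★ `baseChangeHom_mulN`), whence at every field-valued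
  point where `ψ_s`, `λ_{A′,s}`, `λ_{B,s}` are isogenies: `deg ψ_s · deg λ_{B,s} · deg (ψ^∨)_s = c^{2 dim A′_s} · deg λ_{A′,s}`
  (★ `kerRank_mul_mul_kerRank_dualHom_eq`); with `deg λ_{A′,s} = deg λ_{B,s}`: `deg ψ_s · deg (ψ^∨)_s = c^{2 dim A′_s}`.

HC_CM is proved only modulo the printed citations until rung 0 closes; this file changes no count.

## References
* [MumfordFogartyKirwan1994] D. Mumford, J. Fogarty, F. Kirwan, *Geometric Invariant Theory*, 3rd ed. (1994), Ch. 6 §1 Cor. 6.8 (p. 118).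
* [MumfordAV1970] D. Mumford, *Abelian Varieties* (1970), §15 Thm. 1 (p. 143).
* [MilneAV2008] J. S. Milne, *Abelian Varieties* (2008), I §9 Thm. 9.1 (p. 42).
-/

noncomputable section

universe u

open CategoryTheory CategoryTheory.Limits AlgebraicGeometry MonoidalCategory CartesianMonoidalCategory
open scoped MonObj

-- Mathlib's `Over`/`Scheme` APIs are stated across semireducible wrappers (as in ★ `DualIsogenyBaseChange`).
set_option backward.isDefEq.respectTransparency false

namespace Literature.AlgebraicGeometry.AbelianSchemes

namespace AbelianSchemeOver

open Literature.AlgebraicGeometry.Motives Literature.AlgebraicGeometry.Motives.AbelianVariety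

variable {S : Scheme.{u}} {A' B : AbelianSchemeOver S} {Ω : Type u} [Field Ω]

/-! ## §1 `ψ_s` and `(ψ^∨)_s` as morphisms of abelian varieties over `Ω` -/

/-- `ψ_s = homOfIsMonHom (ψ ×_S s)`: the fibre homomorphism IS the base change read as a morphism of abelian varieties (both are the
Mathlib morphism `(Over.pullback s).map ψ`; definitional bookkeeping between ★ `fibreHom` and ★ `homOfIsMonHom`).
[cite: GortzWedhorn2020, Section (4.7) (p. 135)] -/
theorem fibreHom_eq_homOfIsMonHom_baseChangeHom (ψ : A'.X ⟶ B.X) [IsMonHom ψ] (s : Spec (.of Ω) ⟶ S) :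
    haveI := isMonHom_baseChangeHom ψ s
    fibreHom ψ s = homOfIsMonHom (baseChangeHom ψ s) :=
  AbelianVariety.hom_ext _ _ rfl

namespace DualPair

variable (ψ : A'.X ⟶ B.X) [IsMonHom ψ] (D' : A'.DualPair) (DB : B.DualPair)
  (hD' : Nonempty ((Scheme.Modules.pullback (unitHatSlice D')).obj D'.P ≅ SheafOfModules.unit _))
  (hDB : Nonempty ((Scheme.Modules.pullback (unitHatSlice DB)).obj DB.P ≅ SheafOfModules.unit _))
  (s : Spec (.of Ω) ⟶ S)

/-- **`(ψ^∨) ×_S s = (ψ ×_S s)^∨`** in `Over (Spec Ω)`: the base change of the dual homomorphism is the dual homomorphism of the base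
change with respect to the base-changed dual pairs (★ `dualIsogeny_baseChange_eq_lift` + Mathlib `Over.pullback_map_left`).
[cite: MumfordFogartyKirwan1994, Ch. 6 §1 Cor. 6.8 (p. 118)] -/
theorem baseChangeHom_dualIsogenyOver :
    baseChangeHom (A := DB.hat) (B := D'.hat) (dualIsogenyOver ψ D' DB) s =
      @dualIsogenyOver _ (A'.baseChange s) (B.baseChange s) (baseChangeHom ψ s) (isMonHom_baseChangeHom ψ s)
        (D'.baseChange s) (DB.baseChange s) := by
  apply Over.OverMorphism.ext
  rw [dualIsogenyOver_left]
  apply pullback.hom_ext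
  · rw [dualIsogeny_baseChange_comp_fst, baseChangeHom_left_comp_fst, dualIsogenyOver_left]
  · rw [dualIsogeny_baseChange_comp_snd]
    exact Over.w (baseChangeHom (A := DB.hat) (B := D'.hat) (dualIsogenyOver ψ D' DB) s)

/-- **`(ψ^∨)_s = (ψ_s)^∨` as morphisms of abelian varieties over `Ω`**: the fibre of `ψ^∨` at `s` (★ `fibreHom`, `ψ^∨` assumed a
homomorphism) IS ★ `dualHom` of `ψ ×_S s` with respect to the base-changed dual pairs `D′_s`, `D_{B,s}` (their unit hypotheses by ★
`nonempty_unitHatSlice_baseChange_iso`). [cite: MumfordFogartyKirwan1994, Ch. 6 §1 Cor. 6.8 (p. 118)] [cite: MumfordAV1970, §15 Thm. 1 (p. 143)] -/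
theorem fibreHom_dualIsogenyOver_eq_dualHom [IsMonHom (dualIsogenyOver ψ D' DB)] :
    haveI := isMonHom_baseChangeHom ψ s
    fibreHom (dualIsogenyOver ψ D' DB) s =
      dualHom (baseChangeHom ψ s) (D'.baseChange s) (DB.baseChange s) (D'.nonempty_unitHatSlice_baseChange_iso (g := s) hD')
        (DB.nonempty_unitHatSlice_baseChange_iso (g := s) hDB) := by
  refine AbelianVariety.hom_ext _ _ ?_
  rw [fibreHom_hom_hom_hom, dualHom_hom]
  exact baseChangeHom_dualIsogenyOver ψ D' DB s

/-! ## §2 `ψ_s` isogeny ⟹ `(ψ^∨)_s` isogeny -/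

include hD' hDB in
/-- **If `ψ_s` is an isogeny then `(ψ^∨)_s` is an isogeny** (★ `isIsogeny_dualHom` — the dual of an isogeny is an isogeny — at the fibre,
through §1). [cite: MilneAV2008, I §9 Thm. 9.1 (p. 42)] [cite: MumfordAV1970, §15 Thm. 1 (p. 143)] -/
theorem isIsogeny_fibreHom_dualIsogenyOver [IsMonHom (dualIsogenyOver ψ D' DB)] (hψ : IsIsogeny (fibreHom ψ s)) :
    IsIsogeny (fibreHom (dualIsogenyOver ψ D' DB) s) := by
  haveI := isMonHom_baseChangeHom ψ s
  rw [fibreHom_dualIsogenyOver_eq_dualHom ψ D' DB (hD' := hD') (hDB := hDB) (s := s)]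
  rw [fibreHom_eq_homOfIsMonHom_baseChangeHom] at hψ
  exact isIsogeny_dualHom _ _ _ _ _ hψ

/-! ## §3 The fibrewise similitude degree law -/

/-- **The similitude equation base-changes to the fibre**: `ψ ≫ λ_B ≫ ψ^∨ = λ_{A′} ≫ [c]_{Â′}` over `S` gives
`ψ_s ≫ λ_{B,s} ≫ (ψ_s)^∨ = λ_{A′,s} ≫ [c]_{Â′_s}` over `Spec Ω` (functoriality of `×_S s`, §1, ★ `baseChangeHom_mulN`).
[cite: MumfordFogartyKirwan1994, Ch. 6 §1 Cor. 6.8 (p. 118)] -/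
theorem baseChangeHom_similitude (lamA : A'.X ⟶ D'.hat.X) (lamB : B.X ⟶ DB.hat.X) (c : ℕ)
    (h : ψ ≫ lamB ≫ dualIsogenyOver ψ D' DB = lamA ≫ D'.hat.mulN c) :
    baseChangeHom ψ s ≫ baseChangeHom lamB s ≫
        @dualIsogenyOver _ (A'.baseChange s) (B.baseChange s) (baseChangeHom ψ s) (isMonHom_baseChangeHom ψ s)
          (D'.baseChange s) (DB.baseChange s) =
      baseChangeHom lamA s ≫ (D'.baseChange s).hat.mulN c := by
  rw [← baseChangeHom_dualIsogenyOver ψ D' DB s]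
  have h' := congrArg (fun f => (Over.pullback s).map f) h
  simp only [Functor.map_comp] at h'
  rw [show (Over.pullback s).map (D'.hat.mulN c) = (D'.baseChange s).hat.mulN c from D'.hat.baseChangeHom_mulN s c] at h'
  exact h'

include hD' hDB in
/-- **THE FIBREWISE SIMILITUDE DEGREE LAW.** Let `ψ : A′ → B`, `λ_{A′} : A′ → Â′`, `λ_B : B → B̂` be homomorphisms of abelian `S`-schemes
with `ψ ≫ λ_B ≫ ψ^∨ = λ_{A′} ≫ [c]_{Â′}` over `S` (`c ≥ 1`), and `s : Spec Ω → S` a field-valued point at which `ψ_s`, `λ_{A′,s}`, `λ_{B,s}`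
are isogenies.  Then `deg ψ_s · deg λ_{B,s} · deg (ψ^∨)_s = c^{2 dim A′_s} · deg λ_{A′,s}` (★ `kerRank_mul_mul_kerRank_dualHom_eq` at the fibre).
[cite: MumfordAV1970, §15 Thm. 1 (p. 143); §23] [cite: GortzWedhorn2023, Prop. 27.186 (p. 887)] -/
theorem kerRank_fibreHom_mul_mul_kerRank_fibreHom_dualIsogenyOver_eq [IsMonHom (dualIsogenyOver ψ D' DB)]
    (lamA : A'.X ⟶ D'.hat.X) [IsMonHom lamA] (lamB : B.X ⟶ DB.hat.X) [IsMonHom lamB] {c : ℕ} (hc : c ≠ 0)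
    (h : ψ ≫ lamB ≫ dualIsogenyOver ψ D' DB = lamA ≫ D'.hat.mulN c)
    (hψ : IsIsogeny (fibreHom ψ s)) (hlamA : IsIsogeny (fibreHom lamA s)) (hlamB : IsIsogeny (fibreHom lamB s)) :
    Hom.kerRank (fibreHom ψ s) * Hom.kerRank (fibreHom lamB s) * Hom.kerRank (fibreHom (dualIsogenyOver ψ D' DB) s) =
      c ^ (2 * (A'.fibre s).toAbelianVariety.dim) * Hom.kerRank (fibreHom lamA s) := by
  haveI := isMonHom_baseChangeHom ψ s
  haveI := isMonHom_baseChangeHom lamA s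
  haveI := isMonHom_baseChangeHom lamB s
  rw [fibreHom_dualIsogenyOver_eq_dualHom ψ D' DB (hD' := hD') (hDB := hDB) (s := s),
    fibreHom_eq_homOfIsMonHom_baseChangeHom ψ s, fibreHom_eq_homOfIsMonHom_baseChangeHom lamB s,
    fibreHom_eq_homOfIsMonHom_baseChangeHom lamA s]
  rw [fibreHom_eq_homOfIsMonHom_baseChangeHom] at hψ hlamA hlamB
  exact kerRank_mul_mul_kerRank_dualHom_eq (baseChangeHom ψ s) (D'.baseChange s) (DB.baseChange s) _ _ hψ
    (baseChangeHom lamA s) (baseChangeHom lamB s) hlamA hlamB hc (baseChangeHom_similitude ψ D' DB s lamA lamB c h)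

include hD' hDB in
/-- **Same, with `deg λ_{A′,s} = deg λ_{B,s}`** (e.g. principal polarizations): `deg ψ_s · deg (ψ^∨)_s = c^{2 dim A′_s}` — row (H4) of the
ST-0′ package in route (R2), at every field-valued point of the base. [cite: MumfordAV1970, §15 Thm. 1 (p. 143); §23]
[cite: GortzWedhorn2023, Prop. 27.186 (p. 887)] -/
theorem kerRank_fibreHom_mul_kerRank_fibreHom_dualIsogenyOver_eq_pow [IsMonHom (dualIsogenyOver ψ D' DB)]
    (lamA : A'.X ⟶ D'.hat.X) [IsMonHom lamA] (lamB : B.X ⟶ DB.hat.X) [IsMonHom lamB] {c : ℕ} (hc : c ≠ 0)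
    (h : ψ ≫ lamB ≫ dualIsogenyOver ψ D' DB = lamA ≫ D'.hat.mulN c)
    (hψ : IsIsogeny (fibreHom ψ s)) (hlamA : IsIsogeny (fibreHom lamA s)) (hlamB : IsIsogeny (fibreHom lamB s))
    (hdeg : Hom.kerRank (fibreHom lamA s) = Hom.kerRank (fibreHom lamB s)) :
    Hom.kerRank (fibreHom ψ s) * Hom.kerRank (fibreHom (dualIsogenyOver ψ D' DB) s) = c ^ (2 * (A'.fibre s).toAbelianVariety.dim) := by
  have hmain := kerRank_fibreHom_mul_mul_kerRank_fibreHom_dualIsogenyOver_eq ψ D' DB (hD' := hD') (hDB := hDB) (s := s) lamA lamB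
    hc h hψ hlamA hlamB
  have hpos : 0 < Hom.kerRank (fibreHom lamB s) := by
    haveI := hlamB.2
    exact Hom.kerRank_pos _
  rw [hdeg, mul_right_comm] at hmain
  exact Nat.eq_of_mul_eq_mul_right hpos hmain

end DualPair

end AbelianSchemeOver

end Literature.AlgebraicGeometry.AbelianSchemes

end
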